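import Summits.AtomisticToContinuum.Crystallization.Theses.PerronTransitivity

/-!
# Negative knowledge for crux `PerronTransitivity.NoFractionalGain` (K*, stmt-AtomisticToContinuum-15098):
# both hypotheses of K* are load-bearing

Refuter vetting (crux disprover, `--supports stmt-AtomisticToContinuum-15098`).  The crux K* reads
`∀ N (x : Fin N → ℝ³), x injective → ∀ c : Fin N → ℝ, c ≥ 0 →`
`  2·E*·∑ cᵢ² ≤ ∑_i ∑_{j ≠ i} cᵢ cⱼ V_LJ(dist xᵢ xⱼ)`, `E* = ⨅_Q e_LJ(Q)`.
It has exactly two hypotheses, and each is necessary ("any proof must use it"):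

* `false_without_nonneg` — dropping `c ≥ 0` (sign-free site weights, i.e. an operator-norm form with NO
  separation) is FALSE: the dipole `c = (1, −1)` on two points at distance `1/8` has form
  `−2·V_LJ(1/8) < 4·E*`, using only the tree's crude certified floor `E* ≥ −2³²/12`
  (`Blocks.neg_le_energyPerParticle`).  So the copositive (`c ≥ 0`) restriction is essential in the
  separation-free statement; a sign-free form can only hold on `δ`-separated sets with `V_LJ(δ) ≤ 2|E*|`
  (`δ ≥ 0.758…` numerically), cf. the line's abandoned `stub_perronKepler` (sign-free, `2^{-1/6}`-separated).
* `false_without_injective` — dropping injectivity is FALSE because of the real-valued junk `V_LJ(0) = 0`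
  (`0⁻¹ = 0`): a "star" of one point at distance `1` from `k` coincident points has Perron value `√k/12`,
  unbounded in `k` (witness `k = 2⁷⁰`, centre weight `2³⁵`, again only the crude floor is needed).  So the
  finite form of K* genuinely lives on injective configurations; multiplicities are NOT free occupation.
All `[folklore]`.
-/

noncomputable section

namespace Summit.AtomisticToContinuum.Crystallization.Theorems.NoFractionalGain.Negative.LoadBearing

open Literature.MathematicalPhysics.StatisticalMechanics
open Summit.AtomisticToContinuum.Crystallization.Theorems.ChargedEnergyGapNegative
  (eStar Blocks.neg_le_energyPerParticle instNonemptyPeriodicConfiguration)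
open scoped BigOperators

/-! ## The crude certified floor `E* ≥ −2³²/12` -/

/-- `−2³²/12 ≤ E*` (item 0714's explicit constant). [folklore] -/
theorem crude_floor_le_iInf :
    -(65536 ^ 2 / 12 : ℝ) ≤ ⨅ Q : PeriodicConfiguration 3, Q.energyPerParticle lennardJones :=
  le_ciInf fun Q => Blocks.neg_le_energyPerParticle Q

/-! ## K* without `c ≥ 0` -/

/-- The value `V_LJ(1/8) = (8¹² − 2·8⁶)/12`. [folklore] -/
theorem lennardJones_one_eighth : lennardJones (1 / 8) = (8 ^ 12 - 2 * 8 ^ 6) / 12 := by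
  norm_num [lennardJones]

/-- **K* is false without `c ≥ 0`** (K* verbatim with the hypothesis `∀ i, 0 ≤ c i` deleted): the signed
dipole `c = (1, −1)` on two points at distance `1/8`. [folklore] -/
theorem false_without_nonneg :
    ¬ (∀ (N : ℕ) (x : Fin N → EuclideanSpace ℝ (Fin 3)), Function.Injective x → ∀ c : Fin N → ℝ,
        2 * (⨅ Q : PeriodicConfiguration 3, Q.energyPerParticle lennardJones) * ∑ i, c i ^ 2 ≤
          ∑ i, ∑ j ∈ Finset.univ.erase i, c i * c j * lennardJones (dist (x i) (x j))) := by
  intro h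
  set p : EuclideanSpace ℝ (Fin 3) := EuclideanSpace.single 0 (1 / 8 : ℝ) with hp
  have hp0 : p ≠ 0 := by
    intro h0
    have := congrArg (fun v : EuclideanSpace ℝ (Fin 3) => v 0) h0
    simp [hp] at this
  have hnorm : ‖p‖ = 1 / 8 := by
    rw [hp]; simp
  let x : Fin 2 → EuclideanSpace ℝ (Fin 3) := ![p, 0]
  have hx : Function.Injective x := by
    intro i j hij
    fin_cases i <;> fin_cases j
    · rfl
    · simp [x] at hij
      exact absurd hij hp0
    · simp [x] at hij
      exact absurd hij.symm hp0
    · rfl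
  have h01 : dist (x 0) (x 1) = 1 / 8 := by simp [x, hnorm]
  have h10 : dist (x 1) (x 0) = 1 / 8 := by rw [dist_comm]; exact h01
  have key := h 2 x hx ![1, -1]
  have hsum : ∑ i : Fin 2, ∑ j ∈ Finset.univ.erase i,
      (![1, -1] : Fin 2 → ℝ) i * (![1, -1] : Fin 2 → ℝ) j * lennardJones (dist (x i) (x j)) =
        -2 * lennardJones (1 / 8) := by
    rw [Fin.sum_univ_two]
    have e0 : (Finset.univ : Finset (Fin 2)).erase 0 = {1} := by decide
    have e1 : (Finset.univ : Finset (Fin 2)).erase 1 = {0} := by decide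
    rw [e0, e1, Finset.sum_singleton, Finset.sum_singleton, h01, h10]
    simp; ring
  have hsq : ∑ i : Fin 2, (![1, -1] : Fin 2 → ℝ) i ^ 2 = 2 := by
    rw [Fin.sum_univ_two]; simp; norm_num
  rw [hsum, hsq, lennardJones_one_eighth] at key
  have hfloor := crude_floor_le_iInf
  nlinarith

/-! ## K* without injectivity -/

/-- **K* is false without injectivity** (junk `V_LJ(0) = 0`): one point at distance `1` from `k = 2⁷⁰`
coincident points, centre weight `2³⁵`, the others `1` (K* verbatim with `Function.Injective x` deleted).
[folklore] -/
theorem false_without_injective :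
    ¬ (∀ (N : ℕ) (x : Fin N → EuclideanSpace ℝ (Fin 3)) (c : Fin N → ℝ), (∀ i, 0 ≤ c i) →
        2 * (⨅ Q : PeriodicConfiguration 3, Q.energyPerParticle lennardJones) * ∑ i, c i ^ 2 ≤
          ∑ i, ∑ j ∈ Finset.univ.erase i, c i * c j * lennardJones (dist (x i) (x j))) := by
  intro h
  set p : EuclideanSpace ℝ (Fin 3) := EuclideanSpace.single 0 (1 : ℝ) with hp
  have hnorm : ‖p‖ = 1 := by rw [hp]; simp
  set k : ℕ := 2 ^ 70 with hk
  set K₀ : ℝ := 2 ^ 35 with hK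
  let x : Fin (k + 1) → EuclideanSpace ℝ (Fin 3) := fun i => if i = 0 then p else 0
  let c : Fin (k + 1) → ℝ := fun i => if i = 0 then K₀ else 1
  have hc : ∀ i, 0 ≤ c i := by
    intro i; by_cases hi : i = 0 <;> simp [c, hi, hK]
  have key := h (k + 1) x c hc
  -- the norm: ∑ cᵢ² = K₀² + k
  have hsq : ∑ i : Fin (k + 1), c i ^ 2 = K₀ ^ 2 + k := by
    rw [← Finset.add_sum_erase Finset.univ _ (Finset.mem_univ (0 : Fin (k + 1)))]
    have : ∑ i ∈ (Finset.univ : Finset (Fin (k + 1))).erase 0, c i ^ 2 =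
        ∑ _i ∈ (Finset.univ : Finset (Fin (k + 1))).erase 0, (1 : ℝ) := by
      refine Finset.sum_congr rfl fun i hi => ?_
      have hi0 : i ≠ 0 := Finset.ne_of_mem_erase hi
      simp [c, hi0]
    rw [this, Finset.sum_const, Finset.card_erase_of_mem (Finset.mem_univ _), Finset.card_univ,
      Fintype.card_fin]
    simp [c]
  -- row 0 of the form
  have hrow0 : ∑ j ∈ (Finset.univ : Finset (Fin (k + 1))).erase 0,
      c 0 * c j * lennardJones (dist (x 0) (x j)) = (k : ℝ) * (-(K₀ / 12)) := by
    have : ∀ j ∈ (Finset.univ : Finset (Fin (k + 1))).erase 0,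
        c 0 * c j * lennardJones (dist (x 0) (x j)) = -(K₀ / 12) := by
      intro j hj
      have hj0 : j ≠ 0 := Finset.ne_of_mem_erase hj
      simp only [c, x, if_pos rfl, if_neg hj0, dist_zero_right, hnorm, lennardJones_one]
      ring
    rw [Finset.sum_congr rfl this, Finset.sum_const, Finset.card_erase_of_mem (Finset.mem_univ _),
      Finset.card_univ, Fintype.card_fin]
    simp
  -- the other rows are ≤ 0
  have hrows : ∀ i ∈ (Finset.univ : Finset (Fin (k + 1))).erase 0,
      ∑ j ∈ Finset.univ.erase i, c i * c j * lennardJones (dist (x i) (x j)) ≤ 0 := by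
    intro i hi
    have hi0 : i ≠ 0 := Finset.ne_of_mem_erase hi
    refine Finset.sum_nonpos fun j _ => ?_
    by_cases hj0 : j = 0
    · subst hj0
      simp only [c, x, if_neg hi0, if_pos rfl, dist_zero_left, hnorm, lennardJones_one]
      rw [hK]; norm_num
    · simp [c, x, hi0, hj0, lennardJones]
  have hform : ∑ i : Fin (k + 1), ∑ j ∈ Finset.univ.erase i, c i * c j * lennardJones (dist (x i) (x j))
      ≤ (k : ℝ) * (-(K₀ / 12)) := by
    rw [← Finset.add_sum_erase Finset.univ _ (Finset.mem_univ (0 : Fin (k + 1))), hrow0]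
    have := Finset.sum_nonpos hrows
    linarith
  rw [hsq] at key
  have hfloor := crude_floor_le_iInf
  have hkpos : (0 : ℝ) < k := by rw [hk]; positivity
  have hkR : (k : ℝ) = 2 ^ 70 := by rw [hk]; norm_num
  -- 2·E*·(K₀²+k) ≥ 2·(−2³²/12)·(2⁷⁰+2⁷⁰) = −2¹⁰³/3 > −2¹⁰⁵/12 = k·(−K₀/12) ≥ form: contradiction
  rw [hK] at key hform
  rw [hkR] at key hform
  nlinarith
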